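import Summits.ResolutionOfSingularities.ResolutionOfSingularities.Theorems.FrobeniusClosingPatchingRelPerfectConeDepthLineLadder
import Summits.ResolutionOfSingularities.ResolutionOfSingularities.Theorems.FrobeniusClosingPatchingRelPerfectConeDepthLineFibre
import Literature.AlgebraicGeometry.Resolution.AlterationsEnlargingZ
import Literature.AlgebraicGeometry.Resolution.CanonicalResolutionSmoothCentre
import HarnessLib

/-!
# Crux `PatchingRelPerfect` (stmt-ResolutionOfSingularities-16161), chain W5.2 — rung «r-binary-disc-ℓ», ONE RUNG of the
# LINE-centre ladder: blowing up the bad line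

[OURS · L1 W5.2 · rung tool] Replaces the role of NO printed item; NOT a statement of the manuscript under review; fact-free,
any characteristic, any residue field.  AI-written (AI review is weaker than expert review).

`ConeDepth.LineState.step`: blowing up the centre `𝓩 = P₁ ⊔ P₂ ⊔ E` (the reduced bad line, a regular curve) turns a
`LineState … a b` on `X` into a `LineState` on `X'` with `M' = σ^*M · 𝓘_{E'}^m`, `m = min (a+2) b`, exponents
`(a + 2 − m, b − m)`; the new line data and the simple normal crossings over the old line come from THE LINE FIBRE THEOREM
`ConeDepth.line_fibre` (fed with a completion of `(c₀, c₁, c₂)` to a regular system of parameters), everything else is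
transported through the stalk isomorphisms off the centre.

## References
* J. Kollár, *Lectures on Resolution of Singularities* (2007), 3.61, (3.111) Step 3. [Kollar2007]
* Q. Liu, *Algebraic Geometry and Arithmetic Curves*, OUP 2002, Thm. 8.1.19 (a). [Liu2002]
* The Stacks Project, Tag 080B. [StacksProject]
-/

set_option linter.dupNamespace false

noncomputable section

open CategoryTheory CategoryTheory.Limits AlgebraicGeometry TopologicalSpace IsLocalRing
open Literature.AlgebraicGeometry.Resolution
open Scheme.IdealSheafData
open scoped Pointwise

namespace Summit.ResolutionOfSingularities.ResolutionOfSingularities.Theorems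

universe u

namespace ConeDepth

namespace LineState

variable {S : Type u} [CommRing S] [IsRegularLocalRing S] {I : Ideal S} {X : Scheme.{u}} {g : X ⟶ Spec (.of S)}
  {M 𝓗 E P₁ P₂ : X.IdealSheafData} {A B : List (X.IdealSheafData × ℕ)} {a b : ℕ}


/-- **ONE RUNG: blowing up the bad line** (the centre `𝓩 = P₁ ⊔ P₂ ⊔ E`).  The transformed data form a state on `X'`:
`g' = σ ≫ g`, `M' = σ^*M · 𝓘_{E'}^m` (`m = min (a+2) b`), host `σᶜ(𝓗, 2)`, new carrier `E' = σ^*𝓩`, planes `σᶜ(P_k, 1)`, carriers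
the pull-backs of the old ones and `σᶜ(E, 1)` (exponents `a`, `b`), new exponents `(a + 2 - m, b - m)`; THE LINE FIBRE THEOREM at
every point of the old line provides the new line data and the simple normal crossings. [cite: Kollar2007, 3.61 and (3.111) Step 3]
[cite: Liu2002, Thm. 8.1.19 (a)] [cite: StacksProject, Tag 080B] -/
theorem step (h : LineState I X g M 𝓗 E P₁ P₂ A B a b) {X' : Scheme.{u}} {σ : X' ⟶ X} (hσ : IsBlowup σ (P₁ ⊔ P₂ ⊔ E)) :
    LineState I X' (σ ≫ g)
      (M.comap σ * (P₁ ⊔ P₂ ⊔ E).comap σ ^ min (a + 2) b)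
      (controlledTransform σ (P₁ ⊔ P₂ ⊔ E) 𝓗 2) ((P₁ ⊔ P₂ ⊔ E).comap σ)
      (controlledTransform σ (P₁ ⊔ P₂ ⊔ E) P₁ 1) (controlledTransform σ (P₁ ⊔ P₂ ⊔ E) P₂ 1)
      (comapExp A σ ++ [(controlledTransform σ (P₁ ⊔ P₂ ⊔ E) E 1, a)])
      (comapExp B σ ++ [(controlledTransform σ (P₁ ⊔ P₂ ⊔ E) E 1, b)])
      (a + 2 - min (a + 2) b) (b - min (a + 2) b) := by
  classical
  set J : X.IdealSheafData := P₁ ⊔ P₂ ⊔ E with hJdef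
  set En : X'.IdealSheafData := J.comap σ with hEn
  set 𝓗' : X'.IdealSheafData := controlledTransform σ J 𝓗 2 with h𝓗'
  set Et : X'.IdealSheafData := controlledTransform σ J E 1 with hEt
  set P₁' : X'.IdealSheafData := controlledTransform σ J P₁ 1 with hP₁'
  set P₂' : X'.IdealSheafData := controlledTransform σ J P₂ 1 with hP₂'
  set m : ℕ := min (a + 2) b with hm
  haveI := h.isIntegral
  haveI := h.isNoetherian
  haveI : IsProper σ := hσ.isProper
  haveI : IsLocallyNoetherian X' := LocallyOfFiniteType.isLocallyNoetherian σ
  have hZ : ∀ x : X, x ∈ J.support ↔ x ∈ P₁.support ∧ x ∈ P₂.support ∧ x ∈ E.support := mem_support_centre_iff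
  -- the two transform identities
  have hH : En ^ 2 * 𝓗' = 𝓗.comap σ := by
    refine pow_mul_controlledTransform_eq σ J hσ.isEffectiveCartier ?_
    rw [← comap_pow]
    exact Scheme.IdealSheafData.comap_mono σ h.host_le_centre_sq
  have hE : En ^ 1 * Et = E.comap σ := by
    refine pow_mul_controlledTransform_eq σ J hσ.isEffectiveCartier ?_
    rw [pow_one]
    exact Scheme.IdealSheafData.comap_mono σ le_sup_right
  rw [pow_one] at hE
  -- THE LINE FIBRE THEOREM at a point of the old line
  have hfib : ∀ z : X, z ∈ P₁.support → z ∈ P₂.support → z ∈ E.support →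
      ∃ z' : X', σ z' = z ∧
        (∃ c' : Fin 3 → X'.presheaf.stalk z', IsRsopPart c' ∧
          stalkIdeal En z' = Ideal.span {c' 0} ∧ stalkIdeal P₁' z' = Ideal.span {c' 1} ∧ stalkIdeal P₂' z' = Ideal.span {c' 2} ∧
          (∃ a' b' : X'.presheaf.stalk z', IsUnit (b' ^ 2 - 4 * a') ∧
            stalkIdeal 𝓗' z' = Ideal.span {c' 1 * c' 1 + b' * (c' 1 * c' 2) + a' * (c' 2 * c' 2)}) ∧
          stalkIdeal Et z' = ⊤) ∧
        ∀ x' : X', σ x' = z → x' ≠ z' →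
          DepthSNC.SNCWithAt [𝓗', En, Et] ⊤ x' ∧ (x' ∉ P₁'.support ∨ x' ∉ P₂'.support) := by
    intro z h1 h2 h3
    obtain ⟨c, hc, hEz, hP₁z, hP₂z, a', b', hD, h𝓗z⟩ := h.line z h1 h2 h3
    haveI := hc.isRegularLocalRing
    obtain ⟨e, xf, hde, hxspan, hxv⟩ := hc.exists_rsop
    have happ : Fin.append c (fun k => xf (Fin.natAdd 3 k)) = xf := by
      funext m
      refine Fin.addCases (fun i => ?_) (fun k => ?_) m
      · rw [Fin.append_left, hxv]
      · rw [Fin.append_right]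
    have hz : Ideal.span (Set.range (Fin.append c fun k => xf (Fin.natAdd 3 k))) = maximalIdeal _ := by rw [happ, hxspan]
    obtain ⟨z', hσz', ⟨c', w', hreg', hz', hd', hEn', hP1', hP2', hab, hEt'⟩, hsnc'⟩ :=
      line_fibre hσ z c _ hz hde (stalkIdeal_centre_eq hEz hP₁z hP₂z) a' b' hD 𝓗 E P₁ P₂ h𝓗z hEz hP₁z hP₂z
    refine ⟨z', hσz', ⟨c', ⟨hreg', e, w', ?_, ?_⟩, hEn', hP1', hP2', hab, hEt'⟩, hsnc'⟩
    · rw [← IsRegularLocalRing.spanFinrank_maximalIdeal, hd']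
    · rw [← range_fin_append, hz']
  -- points of the new line lie over points of the old line
  have hover' : ∀ z' : X', z' ∈ P₁'.support → z' ∈ P₂'.support → z' ∈ En.support →
      σ z' ∈ P₁.support ∧ σ z' ∈ P₂.support ∧ σ z' ∈ E.support := by
    intro z' _ _ h3
    rw [hEn, mem_support_comap_iff_apply] at h3
    exact (hZ _).mp h3
  -- a point of the new line is THE bad point over its image
  have huniq : ∀ z' : X', z' ∈ P₁'.support → z' ∈ P₂'.support → z' ∈ En.support →
      ∀ z'' : X', σ z'' = σ z' → (∀ x' : X', σ x' = σ z' → x' ≠ z'' →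
        DepthSNC.SNCWithAt [𝓗', En, Et] ⊤ x' ∧ (x' ∉ P₁'.support ∨ x' ∉ P₂'.support)) → z' = z'' := by
    intro z' h1 h2 h3 z'' _ hsnc
    by_contra hne
    rcases (hsnc z' rfl hne).2 with h | h
    · exact h h1
    · exact h h2
  refine
    { isIntegral := ?_
      isNoetherian := ?_
      isRegular := ?_
      exists_isBlowup := ?_
      isLocallyPrincipal := (h.isLocallyPrincipal.comap σ).mul (hσ.isEffectiveCartier.isLocallyPrincipal.pow _)
      boundaryOf_eq := by
        rw [boundaryOf_append, boundaryOf_append, boundaryOf_comapExp, boundaryOf_comapExp, h.boundaryOf_eq]; rfl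
      format := ?_
      nonempty := ?_
      base_eq := ?_
      line := ?_
      not_mem_support := ?_
      snc := ?_ }
  · -- integral: the centre is a non-zero ideal sheaf (`c₀ ≠ 0` at a point of the line)
    refine hσ.isIntegral fun hbot => ?_
    obtain ⟨z, h1, h2, h3⟩ := h.nonempty
    obtain ⟨c, hc, hEz, -⟩ := h.line z h1 h2 h3
    have h0 : c 0 ∈ stalkIdeal J z := by
      rw [hJdef, stalkIdeal_sup, hEz]
      exact Ideal.mem_sup_right (Ideal.mem_span_singleton_self _)
    rw [hbot, stalkIdeal_bot, Ideal.mem_bot] at h0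
    exact hc.ne_zero 0 h0
  · haveI : CompactSpace X' := QuasiCompact.compactSpace_of_compactSpace σ
    exact {}
  · refine IsBlowup.isRegular_of_isRegular_subscheme h.isRegular ?_ hσ
    refine Scheme.isRegular_subscheme_of_forall J fun y hy => ?_
    obtain ⟨h1, h2, h3⟩ := (hZ y).mp hy
    obtain ⟨c, hc, hEz, hP₁z, hP₂z, -⟩ := h.line y h1 h2 h3
    rw [stalkIdeal_centre_eq hEz hP₁z hP₂z]
    exact hc.isRegularLocalRing_quotient
  · obtain ⟨K₀, hg, hK₀⟩ := h.exists_isBlowup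
    exact IsBlowup.exists_isBlowup_comp_supported g K₀ σ J {IsLocalRing.closedPoint S} hg hK₀ hσ fun x hx => by
      obtain ⟨h1, h2, h3⟩ := (hZ x).mp hx
      exact h.base_eq x h1 h2 h3
  · -- THE FORMAT
    have ha : a + 2 = m + (a + 2 - m) := by omega
    have hb : b = m + (b - m) := by omega
    rw [Scheme.IdealSheafData.comap_comp, h.format, comap_mul, Scheme.IdealSheafData.comap_sup, comap_mul,
      ← monomialIdeal_comapExp, ← monomialIdeal_comapExp]
    simp only [comapExp_append, comapExp_cons, comapExp_nil, monomialIdeal_append, monomialIdeal_singleton]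
    rw [← hH, ← hE, ← Scheme.IdealSheafData.add_eq_sup, ← Scheme.IdealSheafData.add_eq_sup]
    exact step_algebra (M.comap σ) 𝓗' (monomialIdeal (comapExp A σ)) (monomialIdeal (comapExp B σ)) En Et ha hb
  · -- the new line is non-empty
    obtain ⟨z, h1, h2, h3⟩ := h.nonempty
    obtain ⟨z', -, ⟨c', hc', hEn', hP1', hP2', -, -⟩, -⟩ := hfib z h1 h2 h3
    have hm' : ∀ k : Fin 3, c' k ∈ maximalIdeal (X'.presheaf.stalk z') := hc'.mem_maximalIdeal
    have hne : ∀ k : Fin 3, Ideal.span {c' k} ≠ ⊤ := fun k htop =>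
      (maximalIdeal.isMaximal _).ne_top (top_le_iff.mp (htop ▸ (Ideal.span_singleton_le_iff_mem _).mpr (hm' k)))
    refine ⟨z', ?_, ?_, ?_⟩
    · rw [mem_support_iff_stalkIdeal_ne_top, hP1']; exact hne 1
    · rw [mem_support_iff_stalkIdeal_ne_top, hP2']; exact hne 2
    · rw [mem_support_iff_stalkIdeal_ne_top, hEn']; exact hne 0
  · intro z' h1 h2 h3
    obtain ⟨g1, g2, g3⟩ := hover' z' h1 h2 h3
    rw [Scheme.Hom.comp_apply]
    exact h.base_eq _ g1 g2 g3
  · -- the line data at a point of the new line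
    intro z' h1 h2 h3
    obtain ⟨g1, g2, g3⟩ := hover' z' h1 h2 h3
    obtain ⟨z'', hσz'', hdata, hsnc⟩ := hfib (σ z') g1 g2 g3
    obtain rfl : z' = z'' := huniq z' h1 h2 h3 z'' hσz'' hsnc
    obtain ⟨c', hc', hEn', hP1', hP2', hab, -⟩ := hdata
    exact ⟨c', hc', hEn', hP1', hP2', hab⟩
  · -- the other carriers miss the new line
    intro D hD z' h1 h2 h3
    obtain ⟨g1, g2, g3⟩ := hover' z' h1 h2 h3
    rw [boundaryOf_append, boundaryOf_comapExp, show boundaryOf [(Et, a)] = [Et] from rfl] at hD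
    rcases List.mem_append.mp hD with hD | hD
    · obtain ⟨D₀, hD₀, rfl⟩ := List.mem_map.mp hD
      rw [mem_support_comap_iff_apply]
      exact h.not_mem_support D₀ hD₀ _ g1 g2 g3
    · rw [List.mem_singleton] at hD
      subst hD
      obtain ⟨z'', hσz'', hdata, hsnc⟩ := hfib (σ z') g1 g2 g3
      obtain rfl : z' = z'' := huniq z' h1 h2 h3 z'' hσz'' hsnc
      obtain ⟨-, -, -, -, -, -, hEt'⟩ := hdata
      rw [mem_support_iff_stalkIdeal_ne_top, hEt']
      exact fun hne => hne rfl
  · -- simple normal crossings over the closed point off the new line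
    intro x' hgx' hnot
    rw [boundaryOf_append, boundaryOf_comapExp, show boundaryOf [(Et, a)] = [Et] from rfl]
    have hcases : ∀ D ∈ 𝓗' :: (((boundaryOf A).map fun K => K.comap σ) ++ [Et] ++ [En]),
        D = 𝓗' ∨ (∃ D₀ ∈ boundaryOf A, D = D₀.comap σ) ∨ D = Et ∨ D = En := by
      intro D hD
      rcases List.mem_cons.mp hD with rfl | hD
      · exact Or.inl rfl
      rcases List.mem_append.mp hD with hD | hD
      · rcases List.mem_append.mp hD with hD | hD
        · obtain ⟨D₀, hD₀, rfl⟩ := List.mem_map.mp hD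
          exact Or.inr (Or.inl ⟨D₀, hD₀, rfl⟩)
        · exact Or.inr (Or.inr (Or.inl (List.mem_singleton.mp hD)))
      · exact Or.inr (Or.inr (Or.inr (List.mem_singleton.mp hD)))
    by_cases hx : σ x' ∈ J.support
    · -- over the old line: the line fibre theorem
      obtain ⟨g1, g2, g3⟩ := (hZ _).mp hx
      obtain ⟨z'', hσz'', hdata, hsnc⟩ := hfib (σ x') g1 g2 g3
      have hne : x' ≠ z'' := by
        rintro rfl
        obtain ⟨c', hc', hEn', hP1', hP2', -, -⟩ := hdata
        have hm' : ∀ k : Fin 3, c' k ∈ maximalIdeal (X'.presheaf.stalk x') := hc'.mem_maximalIdeal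
        have hne : ∀ k : Fin 3, Ideal.span {c' k} ≠ ⊤ := fun k htop =>
          (maximalIdeal.isMaximal _).ne_top (top_le_iff.mp (htop ▸ (Ideal.span_singleton_le_iff_mem _).mpr (hm' k)))
        apply hnot
        refine ⟨?_, ?_, ?_⟩
        · rw [mem_support_iff_stalkIdeal_ne_top, hP1']; exact hne 1
        · rw [mem_support_iff_stalkIdeal_ne_top, hP2']; exact hne 2
        · rw [mem_support_iff_stalkIdeal_ne_top, hEn']; exact hne 0
      refine (hsnc x' rfl hne).1.anti fun D hD hxD => ?_
      rcases hcases D hD with rfl | ⟨D₀, hD₀, rfl⟩ | rfl | rfl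
      · exact List.mem_cons_self
      · exfalso
        rw [mem_support_comap_iff_apply] at hxD
        exact h.not_mem_support D₀ hD₀ _ g1 g2 g3 hxD
      · exact List.mem_cons_of_mem _ (List.mem_cons_of_mem _ (List.mem_singleton_self _))
      · exact List.mem_cons_of_mem _ List.mem_cons_self
    · -- elsewhere: transport through the stalk isomorphism
      haveI := hσ.isIso_stalkMap_of_not_mem_support hx
      have hgx : g (σ x') = IsLocalRing.closedPoint S := by rwa [Scheme.Hom.comp_apply] at hgx'
      have hold := h.snc (σ x') hgx (fun hh => hx ((hZ _).mpr hh))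
      obtain ⟨z₀, hz1, hz2, hz3⟩ := h.nonempty
      let τ : X.IdealSheafData → X'.IdealSheafData := fun D =>
        if D = E then Et else if D = 𝓗 then 𝓗' else D.comap σ
      have hτE : τ E = Et := by simp only [τ, if_pos rfl]
      have hτH : τ 𝓗 = 𝓗' := by
        show (if 𝓗 = E then Et else if 𝓗 = 𝓗 then 𝓗' else 𝓗.comap σ) = 𝓗'
        rw [if_neg h.host_ne_carrier, if_pos rfl]
      have hτD : ∀ D ∈ boundaryOf A, τ D = D.comap σ := by
        intro D hD
        have hh1 : D ≠ E := fun heq => h.not_mem_support D hD z₀ hz1 hz2 hz3 (heq ▸ hz3)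
        have hh2 : D ≠ 𝓗 := fun heq => h.not_mem_support D hD z₀ hz1 hz2 hz3 (heq ▸ h.mem_support_host hz1 hz2 hz3)
        simp only [τ, if_neg hh1, if_neg hh2]
      have key := sncWithAt_map_of_isIso x' hold τ ?_ [En] ?_
      · refine key.anti fun D hD _ => ?_
        rcases hcases D hD with rfl | ⟨D₀, hD₀, rfl⟩ | rfl | rfl
        · rw [← hτH]
          exact List.mem_append_left _ (List.mem_map_of_mem List.mem_cons_self)
        · rw [← hτD D₀ hD₀]
          exact List.mem_append_left _ (List.mem_map_of_mem (List.mem_cons_of_mem _ (List.mem_append_left _ hD₀)))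
        · rw [← hτE]
          exact List.mem_append_left _
            (List.mem_map_of_mem (List.mem_cons_of_mem _ (List.mem_append_right _ (List.mem_singleton_self _))))
        · exact List.mem_append_right _ (List.mem_singleton_self _)
      · intro D hD _
        by_cases hDE : D = E
        · subst hDE
          rw [hτE]
          exact stalkIdeal_controlledTransform_of_not_mem_support _ 1 hx
        · by_cases hDH : D = 𝓗
          · subst hDH
            rw [hτH]
            exact stalkIdeal_controlledTransform_of_not_mem_support _ 2 hx
          · simp only [τ, if_neg hDE, if_neg hDH]
            exact stalkIdeal_comap_eq_map_stalkMap σ D x'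
      · intro D hD
        rw [List.mem_singleton] at hD
        subst hD
        rw [mem_support_comap_iff_apply]
        exact hx

end LineState

end ConeDepth

end Summit.ResolutionOfSingularities.ResolutionOfSingularities.Theorems

end
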